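import Mathlib
import Summits.Ventures.PercRepro.TriangleCapBipartiteTwo

/-!
# PercRepro — TWO BELOW THE DIAGONAL ON TRIANGLE-FREE GRAPHS, PART A: the per-vertex counts of the
`X = N(v)`, `Y = N(u)`, `Z = V ∖ (X ∪ Y)` split along an edge `u v` (p3, gen 36; part 38)

The lemmas of TriangleCapTriangleFreeTwo's core, stated on explicit sets `X`, `Y`, `Z` with their membership rules
(`memX : w ∈ X ↔ v ~ w`, `memY : w ∈ Y ↔ u ~ w`, `memZ : w ∈ Z ↔ ¬ v ~ w ∧ ¬ u ~ w`) and the two classes of ordered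
adjacent pairs `A₁ ⊆ X × Y`, `A₃ ⊆ Z × (X ∪ Y)` of §10at:

* `far_pairs_lower` — for `z ∈ Z` the pairs `(x, v)`, `x ∈ X ∖ N(z)`, and `(u, y)`, `y ∈ Y ∖ N(z)`, are far from `z`:
  `|X ∖ N(z)| + |Y ∖ N(z)| ≤ |{p ∈ A₁ : p far from z}| + 1`;
* `edges_at_Z_lower` — every edge `z x` (`x ∈ X`) has `X ∖ N(z)` in its deficit, every edge `z y` has `Y ∖ N(z)`:
  `Σ_{z ∈ Z} (|N(z) ∩ X|·|X ∖ N(z)| + |N(z) ∩ Y|·|Y ∖ N(z)|) ≤ Σ_{A₃} deficit`;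
* `per_z_arith` — `|X| + |Y| ≤ |N(z) ∩ X|·|X ∖ N(z)| + |N(z) ∩ Y|·|Y ∖ N(z)| + |X ∖ N(z)| + |Y ∖ N(z)|` (as `u ∈ X ∖ N(z)`,
  `v ∈ Y ∖ N(z)`);
* `xy_pair_lower` — a non-adjacent pair `x₀ ∈ X`, `y₀ ∈ Y` pays `|X| + |Y| − 2` inside `A₁` (§10at's CASE 1 count);
* `bipartite_of_Z_empty`, `bipartite_of_Z_singleton` — with `Z = ∅`, or `Z = {z}` and every `X`–`Y` pair adjacent,
  the graph is bipartite spanning.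
Axioms: standard.
-/

namespace PercRepro

namespace TriangleCap

namespace C047

open Finset

variable {V : Type*} [Fintype V] [DecidableEq V]

omit [Fintype V] in
/-- The pairs `(x, v)`, `x ∈ X ∖ N(z)`, and `(u, y)`, `y ∈ Y ∖ N(z)`, are far from `z`. -/
theorem far_pairs_lower (D : SimpleGraph V) [DecidableRel D.Adj] {u v : V} (huv : D.Adj u v)
    (X Y : Finset V) (memX : ∀ w, w ∈ X ↔ D.Adj v w) (memY : ∀ w, w ∈ Y ↔ D.Adj u w)
    (A₁ : Finset (V × V)) (memA₁ : ∀ p, p ∈ A₁ ↔ D.Adj p.1 p.2 ∧ D.Adj v p.1 ∧ D.Adj u p.2)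
    {z : V} (hz1 : ¬ D.Adj v z) (hz2 : ¬ D.Adj u z) :
    (X.filter (fun x => ¬ D.Adj z x)).card + (Y.filter (fun y => ¬ D.Adj z y)).card ≤
      (A₁.filter (fun p => ¬ D.Adj p.1 z ∧ ¬ D.Adj p.2 z)).card + 1 := by
  obtain ⟨I₁, hI₁⟩ : ∃ I₁ : Finset (V × V), I₁ = (X.filter (fun x => ¬ D.Adj z x)).image (fun x => (x, v)) :=
    ⟨_, rfl⟩
  obtain ⟨I₂, hI₂⟩ : ∃ I₂ : Finset (V × V), I₂ = (Y.filter (fun y => ¬ D.Adj z y)).image (fun y => (u, y)) :=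
    ⟨_, rfl⟩
  have hc1 : I₁.card = (X.filter (fun x => ¬ D.Adj z x)).card := by
    rw [hI₁]
    exact card_image_of_injective _ (fun a b h => (Prod.mk.inj h).1)
  have hc2 : I₂.card = (Y.filter (fun y => ¬ D.Adj z y)).card := by
    rw [hI₂]
    exact card_image_of_injective _ (fun a b h => (Prod.mk.inj h).2)
  have hsub : I₁ ∪ I₂ ⊆ A₁.filter (fun p => ¬ D.Adj p.1 z ∧ ¬ D.Adj p.2 z) := by
    intro p hp
    rw [mem_union, hI₁, hI₂, mem_image, mem_image] at hp
    rw [mem_filter, memA₁]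
    rcases hp with ⟨x, hx, rfl⟩ | ⟨y, hy, rfl⟩
    · rw [mem_filter] at hx
      exact ⟨⟨((memX x).mp hx.1).symm, (memX x).mp hx.1, huv⟩, fun h => hx.2 h.symm, hz1⟩
    · rw [mem_filter] at hy
      exact ⟨⟨(memY y).mp hy.1, huv.symm, (memY y).mp hy.1⟩, hz2, fun h => hy.2 h.symm⟩
  have hinter : (I₁ ∩ I₂).card ≤ 1 := by
    apply card_le_one.mpr
    intro p hp q hq
    rw [mem_inter, hI₁, hI₂, mem_image, mem_image] at hp hq
    obtain ⟨⟨x, _, rfl⟩, ⟨y, _, hpy⟩⟩ := hp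
    obtain ⟨⟨x', _, rfl⟩, ⟨y', _, hqy⟩⟩ := hq
    have e1 := (Prod.mk.inj hpy).1
    have e2 := (Prod.mk.inj hqy).1
    rw [← e1, ← e2]
  have := card_union_add_card_inter I₁ I₂
  have := card_le_card hsub
  omega

/-- Every edge `z x` (`x ∈ X`) has `X ∖ N(z)` in its deficit and every edge `z y` (`y ∈ Y`) has `Y ∖ N(z)`. -/
theorem edges_at_Z_lower (D : SimpleGraph V) [DecidableRel D.Adj]
    (htri : ∀ a b c, D.Adj a b → D.Adj a c → D.Adj b c → False) {u v : V} (huv : D.Adj u v)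
    (X Y Z : Finset V) (memX : ∀ w, w ∈ X ↔ D.Adj v w) (memY : ∀ w, w ∈ Y ↔ D.Adj u w)
    (memZ : ∀ w, w ∈ Z ↔ ¬ D.Adj v w ∧ ¬ D.Adj u w)
    (A₃ : Finset (V × V)) (memA₃ : ∀ p, p ∈ A₃ ↔ D.Adj p.1 p.2 ∧ (¬ D.Adj v p.1 ∧ ¬ D.Adj u p.1) ∧
      (D.Adj v p.2 ∨ D.Adj u p.2)) :
    ∑ z ∈ Z, ((X.filter (fun w => D.Adj z w)).card * (X.filter (fun x => ¬ D.Adj z x)).card +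
      (Y.filter (fun w => D.Adj z w)).card * (Y.filter (fun y => ¬ D.Adj z y)).card) ≤
        ∑ p ∈ A₃, deficit D p := by
  have hXY : ∀ w, D.Adj v w → ¬ D.Adj u w := fun w hv hu => htri u v w huv hu hv
  have hXind : ∀ a b, D.Adj v a → D.Adj v b → ¬ D.Adj a b := fun a b ha hb hab => htri v a b ha hb hab
  have hYind : ∀ a b, D.Adj u a → D.Adj u b → ¬ D.Adj a b := fun a b ha hb hab => htri u a b ha hb hab
  have hXYd : Disjoint X Y := by
    rw [disjoint_left]
    intro w hw1 hw2
    exact hXY w ((memX w).mp hw1) ((memY w).mp hw2)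
  have hA3sub : (Z ×ˢ (X ∪ Y)).filter (fun p => D.Adj p.1 p.2) ⊆ A₃ := by
    intro p hp
    simp only [mem_filter, mem_product, mem_union] at hp
    rw [memA₃]
    refine ⟨hp.2, (memZ p.1).mp hp.1.1, ?_⟩
    rcases hp.1.2 with h | h
    · exact Or.inl ((memX p.2).mp h)
    · exact Or.inr ((memY p.2).mp h)
  calc ∑ z ∈ Z, ((X.filter (fun w => D.Adj z w)).card * (X.filter (fun x => ¬ D.Adj z x)).card +
        (Y.filter (fun w => D.Adj z w)).card * (Y.filter (fun y => ¬ D.Adj z y)).card)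
      ≤ ∑ z ∈ Z, ∑ w ∈ (X ∪ Y).filter (fun w => D.Adj z w), deficit D (z, w) := by
        apply sum_le_sum
        intro z _
        rw [filter_union, sum_union (disjoint_filter_filter hXYd)]
        apply Nat.add_le_add
        · rw [← smul_eq_mul, ← sum_const]
          apply sum_le_sum
          intro w hw
          rw [mem_filter] at hw
          unfold deficit
          apply card_le_card
          intro x hx
          rw [mem_filter] at hx ⊢
          exact ⟨mem_univ _, hx.2, hXind w x ((memX w).mp hw.1) ((memX x).mp hx.1)⟩
        · rw [← smul_eq_mul, ← sum_const]
          apply sum_le_sum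
          intro w hw
          rw [mem_filter] at hw
          unfold deficit
          apply card_le_card
          intro y hy
          rw [mem_filter] at hy ⊢
          exact ⟨mem_univ _, hy.2, hYind w y ((memY w).mp hw.1) ((memY y).mp hy.1)⟩
    _ = ∑ p ∈ (Z ×ˢ (X ∪ Y)).filter (fun p => D.Adj p.1 p.2), deficit D p := by
        rw [sum_filter, sum_product]
        apply sum_congr rfl
        intro z _
        rw [sum_filter]
    _ ≤ ∑ p ∈ A₃, deficit D p :=
        sum_le_sum_of_subset_of_nonneg hA3sub (fun _ _ _ => Nat.zero_le _)

omit [Fintype V] [DecidableEq V] in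
/-- Per `z ∈ Z`: `|X| + |Y| ≤ t·a + s·b + a + b` with `a = |X ∖ N(z)| ≥ 1` (`u`), `b = |Y ∖ N(z)| ≥ 1` (`v`). -/
theorem per_z_arith (D : SimpleGraph V) [DecidableRel D.Adj] {u v : V} (X Y : Finset V) (huX : u ∈ X) (hvY : v ∈ Y)
    {z : V} (hz1 : ¬ D.Adj v z) (hz2 : ¬ D.Adj u z) :
    X.card + Y.card ≤
      ((X.filter (fun w => D.Adj z w)).card * (X.filter (fun x => ¬ D.Adj z x)).card +
        (Y.filter (fun w => D.Adj z w)).card * (Y.filter (fun y => ¬ D.Adj z y)).card) +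
      ((X.filter (fun x => ¬ D.Adj z x)).card + (Y.filter (fun y => ¬ D.Adj z y)).card) := by
  have hXc := card_filter_add_card_filter_not (s := X) (fun w => D.Adj z w)
  have hYc := card_filter_add_card_filter_not (s := Y) (fun w => D.Adj z w)
  have ha1 : 1 ≤ (X.filter (fun x => ¬ D.Adj z x)).card :=
    card_pos.mpr ⟨u, by rw [mem_filter]; exact ⟨huX, fun h => hz2 h.symm⟩⟩
  have hb1 : 1 ≤ (Y.filter (fun y => ¬ D.Adj z y)).card :=
    card_pos.mpr ⟨v, by rw [mem_filter]; exact ⟨hvY, fun h => hz1 h.symm⟩⟩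
  have h1 : (X.filter (fun w => D.Adj z w)).card ≤
      (X.filter (fun w => D.Adj z w)).card * (X.filter (fun x => ¬ D.Adj z x)).card :=
    Nat.le_mul_of_pos_right _ ha1
  have h2 : (Y.filter (fun w => D.Adj z w)).card ≤
      (Y.filter (fun w => D.Adj z w)).card * (Y.filter (fun y => ¬ D.Adj z y)).card :=
    Nat.le_mul_of_pos_right _ hb1
  omega

omit [Fintype V] in
/-- §10at's CASE 1 count: a non-adjacent pair `x₀ ∈ X`, `y₀ ∈ Y` pays `|X| + |Y| − 2` inside `A₁`. -/
theorem xy_pair_lower (D : SimpleGraph V) [DecidableRel D.Adj] {u v : V} (huv : D.Adj u v)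
    (X Y : Finset V) (memX : ∀ w, w ∈ X ↔ D.Adj v w) (memY : ∀ w, w ∈ Y ↔ D.Adj u w)
    (A₁ : Finset (V × V)) (memA₁ : ∀ p, p ∈ A₁ ↔ D.Adj p.1 p.2 ∧ D.Adj v p.1 ∧ D.Adj u p.2)
    {x₀ y₀ : V} (hx₀ : x₀ ∈ X) (hy₀ : y₀ ∈ Y) (hxy : ¬ D.Adj x₀ y₀) :
    X.card + Y.card ≤ ∑ p ∈ A₁, (X.filter (fun w => ¬ D.Adj p.2 w)).card +
      ∑ p ∈ A₁, (Y.filter (fun w => ¬ D.Adj p.1 w)).card + 2 := by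
  have huX : u ∈ X := (memX u).mpr huv.symm
  have hvY : v ∈ Y := (memY v).mpr huv
  have hx₀' := (memX x₀).mp hx₀
  have hy₀' := (memY y₀).mp hy₀
  have hsub1 : (X.filter (fun x => D.Adj y₀ x)).image (fun x => (x, y₀)) ⊆ A₁ := by
    intro p hp
    rw [mem_image] at hp
    obtain ⟨x, hx, rfl⟩ := hp
    rw [mem_filter] at hx
    exact (memA₁ _).mpr ⟨hx.2.symm, (memX x).mp hx.1, hy₀'⟩
  have hp1 : (X.filter (fun x => D.Adj y₀ x)).card * (X.filter (fun w => ¬ D.Adj y₀ w)).card ≤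
      ∑ p ∈ A₁, (X.filter (fun w => ¬ D.Adj p.2 w)).card := by
    calc (X.filter (fun x => D.Adj y₀ x)).card * (X.filter (fun w => ¬ D.Adj y₀ w)).card
        = ∑ x ∈ X.filter (fun x => D.Adj y₀ x), (X.filter (fun w => ¬ D.Adj y₀ w)).card := by
          rw [sum_const, smul_eq_mul]
      _ = ∑ p ∈ (X.filter (fun x => D.Adj y₀ x)).image (fun x => (x, y₀)),
            (X.filter (fun w => ¬ D.Adj p.2 w)).card := by
          rw [sum_image_pair_left]
      _ ≤ ∑ p ∈ A₁, (X.filter (fun w => ¬ D.Adj p.2 w)).card := sum_le_sum_of_subset hsub1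
  have ht1 : 1 ≤ (X.filter (fun x => D.Adj y₀ x)).card :=
    card_pos.mpr ⟨u, by rw [mem_filter]; exact ⟨huX, hy₀'.symm⟩⟩
  have ht2 : 1 ≤ (X.filter (fun w => ¬ D.Adj y₀ w)).card :=
    card_pos.mpr ⟨x₀, by rw [mem_filter]; exact ⟨hx₀, fun h => hxy h.symm⟩⟩
  have ht3 := card_filter_add_card_filter_not (s := X) (fun x => D.Adj y₀ x)
  have hsub2 : (Y.filter (fun y => D.Adj x₀ y)).image (fun y => (x₀, y)) ⊆ A₁ := by
    intro p hp
    rw [mem_image] at hp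
    obtain ⟨y, hy, rfl⟩ := hp
    rw [mem_filter] at hy
    exact (memA₁ _).mpr ⟨hy.2, hx₀', (memY y).mp hy.1⟩
  have hp2 : (Y.filter (fun y => D.Adj x₀ y)).card * (Y.filter (fun w => ¬ D.Adj x₀ w)).card ≤
      ∑ p ∈ A₁, (Y.filter (fun w => ¬ D.Adj p.1 w)).card := by
    calc (Y.filter (fun y => D.Adj x₀ y)).card * (Y.filter (fun w => ¬ D.Adj x₀ w)).card
        = ∑ y ∈ Y.filter (fun y => D.Adj x₀ y), (Y.filter (fun w => ¬ D.Adj x₀ w)).card := by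
          rw [sum_const, smul_eq_mul]
      _ = ∑ p ∈ (Y.filter (fun y => D.Adj x₀ y)).image (fun y => (x₀, y)),
            (Y.filter (fun w => ¬ D.Adj p.1 w)).card := by
          rw [sum_image_pair_right]
      _ ≤ ∑ p ∈ A₁, (Y.filter (fun w => ¬ D.Adj p.1 w)).card := sum_le_sum_of_subset hsub2
  have hs1 : 1 ≤ (Y.filter (fun y => D.Adj x₀ y)).card :=
    card_pos.mpr ⟨v, by rw [mem_filter]; exact ⟨hvY, hx₀'.symm⟩⟩
  have hs2 : 1 ≤ (Y.filter (fun w => ¬ D.Adj x₀ w)).card :=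
    card_pos.mpr ⟨y₀, by rw [mem_filter]; exact ⟨hy₀, hxy⟩⟩
  have hs3 := card_filter_add_card_filter_not (s := Y) (fun y => D.Adj x₀ y)
  have hm1 := mul_ge_add_sub_one _ _ ht1 ht2
  have hm2 := mul_ge_add_sub_one _ _ hs1 hs2
  omega

omit [Fintype V] [DecidableEq V] in
/-- `Z = ∅`: the graph is bipartite spanning with parts `X = N(v)` and `Y = N(u)`. -/
theorem bipartite_of_Z_empty (D : SimpleGraph V) [DecidableRel D.Adj]
    (htri : ∀ a b c, D.Adj a b → D.Adj a c → D.Adj b c → False) {u v : V}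
    (X : Finset V) (memX : ∀ w, w ∈ X ↔ D.Adj v w) (hZe : ∀ w, D.Adj v w ∨ D.Adj u w) :
    ∃ A : Finset V, ∀ x y, D.Adj x y → (x ∈ A ↔ y ∉ A) := by
  have hXind : ∀ a b, D.Adj v a → D.Adj v b → ¬ D.Adj a b := fun a b ha hb hab => htri v a b ha hb hab
  have hYind : ∀ a b, D.Adj u a → D.Adj u b → ¬ D.Adj a b := fun a b ha hb hab => htri u a b ha hb hab
  refine ⟨X, fun a b hab => ?_⟩
  rw [memX, memX]
  constructor
  · intro ha hb
    exact hXind a b ha hb hab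
  · intro hb
    by_contra ha
    have ha' := (hZe a).resolve_left ha
    have hb' := (hZe b).resolve_left hb
    exact hYind a b ha' hb' hab

omit [Fintype V] in
/-- `Z = {z}` with every `X`–`Y` pair adjacent: `z` has neighbours on one side only and the graph is bipartite
spanning. -/
theorem bipartite_of_Z_singleton (D : SimpleGraph V) [DecidableRel D.Adj]
    (htri : ∀ a b c, D.Adj a b → D.Adj a c → D.Adj b c → False) {u v : V}
    (X Y : Finset V) (memX : ∀ w, w ∈ X ↔ D.Adj v w) (memY : ∀ w, w ∈ Y ↔ D.Adj u w)
    {z : V} (hclass : ∀ w, D.Adj v w ∨ D.Adj u w ∨ w = z)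
    (hall : ∀ x ∈ X, ∀ y ∈ Y, D.Adj x y) :
    ∃ A : Finset V, ∀ x y, D.Adj x y → (x ∈ A ↔ y ∉ A) := by
  have hXind : ∀ a b, D.Adj v a → D.Adj v b → ¬ D.Adj a b := fun a b ha hb hab => htri v a b ha hb hab
  have hYind : ∀ a b, D.Adj u a → D.Adj u b → ¬ D.Adj a b := fun a b ha hb hab => htri u a b ha hb hab
  by_cases hside : ∃ y ∈ Y, D.Adj z y
  · obtain ⟨y, hy, hzy⟩ := hside
    have hnoX : ∀ x ∈ X, ¬ D.Adj z x := fun x hx hzx => htri z x y hzx hzy (hall x hx y hy)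
    refine ⟨X ∪ {z}, fun a b hab => ?_⟩
    simp only [mem_union, mem_singleton, memX]
    constructor
    · rintro (ha | rfl) hb
      · rcases hb with hb | rfl
        · exact hXind a b ha hb hab
        · exact hnoX a ((memX a).mpr ha) hab.symm
      · rcases hb with hb | rfl
        · exact hnoX b ((memX b).mpr hb) hab
        · exact hab.ne rfl
    · intro hb
      by_contra ha
      rw [not_or] at ha hb
      rcases hclass a with h | h | h
      · exact ha.1 h
      · rcases hclass b with h' | h' | h'
        · exact hb.1 h'
        · exact hYind a b h h' hab
        · exact hb.2 h'
      · exact ha.2 h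
  · have hnoY : ∀ y ∈ Y, ¬ D.Adj z y := fun y hy h => hside ⟨y, hy, h⟩
    refine ⟨X, fun a b hab => ?_⟩
    rw [memX, memX]
    constructor
    · intro ha hb
      exact hXind a b ha hb hab
    · intro hb
      by_contra ha
      rcases hclass a with h | h | rfl
      · exact ha h
      · rcases hclass b with h' | h' | rfl
        · exact hb h'
        · exact hYind a b h h' hab
        · exact hnoY a ((memY a).mpr h) hab.symm
      · rcases hclass b with h' | h' | rfl
        · exact hb h'
        · exact hnoY b ((memY b).mpr h') hab
        · exact hab.ne rfl

end C047

end TriangleCap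

end PercRepro
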